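import Mathlib
import HarnessLib
import Literature.NumberTheory.GaloisRepresentations.ChenevierUniversalDeterminantRing
import Summits.Langlands.Langlands.Theorems.EisensteinGelfandKirillovProModularOfGKBoundStubNoetherianDeterminant

/-!
# Route `EisensteinGelfandKirillov`, crux `ProModularOfGKBound` (stmt-Langlands-18273), line
# `two-leaf-fern`: hosts are Noetherian, from Chenevier's universal ring and `Φ_p` for `G_{F,S}`
# (the registered stub `stub_noetherianOf`, part 3 of 3)

The registered stub `stub_noetherianOf`: GIVEN the two named facts
`Chenevier2014_universalDeterminantRingTwo` (Chenevier's compact Hausdorff local NOETHERIAN universal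
deformation ring of a continuous `2`-dimensional determinant over a finite field, for a profinite group
satisfying Mazur's `Φ_p` [cite: Chenevier2014, §3.1 Prop. 3.3, Prop. 3.7]) and
`galoisGroupUnramifiedOutside_phiP` (`Φ_p` for `G_{F,S}`, `S` finite [cite: Mazur1989Deforming, §1.2]),
the coefficient ring `ℋ.R` of every pseudo-deformation host `ℋ : Host p O ρ ρ₀` of an a.e.-unramified
`ρ` (`p ≥ 5`) is Noetherian.  Proof: the host's determinant `(T, det₂)` (part 2) descends to a continuous
determinant of the profinite group `G_{F,S}`, `S = badSet p ρ` finite (`badSet_finite`), reducing to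
`D̄ = D mod 𝔪_R` over the finite discrete residue field (part 1); the classifying map `φ : R^u → ℋ.R` of
Chenevier's universal ring hits every `T g`, so it is onto by (G) and `ℋ.R` is a quotient of the
Noetherian `R^u` (`stub_noetherianAux2` = `Host.isNoetherianRing_of_cover`).

§1 supplies the one remaining topological input: the quotient of a profinite group by a closed normal
subgroup is totally separated, so `G_{F,S} = Γ_F ⧸ N_S` is profinite
(`instTotallySeparatedSpace_galoisGroupUnramifiedOutside`); §2 is the stub.
-/

set_option linter.dupNamespace false
set_option autoImplicit false

noncomputable section

open scoped NumberField Matrix Topology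
open Filter Field IsDedekindDomain
open Literature.NumberTheory.GaloisRepresentations Literature.NumberTheory.Automorphic
open Literature.NumberTheory.Automorphic.BigHeckeGLn

namespace Summit.Langlands.Langlands.Cruxes.ProModularOfGKBound.TwoLeafFern

/-! ## 1. Profinite quotients (for `G_{F,S} = Γ_F ⧸ N_S`) -/

section ProfiniteQuotient

/-- **The quotient of a profinite group by a closed normal subgroup is totally separated** (hence
profinite): if `aN ≠ bN` then `a⁻¹b ∉ N = ⋂ {O open subgroup ⊇ N}`
(`ProfiniteGrp.closedSubgroup_eq_sInf_open`), and for such an `O ∌ a⁻¹b` the image of the clopen,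
`N`-saturated set `aO` in `G ⧸ N` is a clopen set containing `aN` but not `bN`.  (Used for
`G_{F,S}`, the quotient of the profinite `Γ_F` by the closed ramification subgroup.) [folklore] -/
theorem totallySeparatedSpace_quotient_of_isClosed {G : Type*} [Group G] [TopologicalSpace G]
    [IsTopologicalGroup G] [CompactSpace G] [TotallyDisconnectedSpace G] (N : Subgroup G)
    [N.Normal] (hN : IsClosed (N : Set G)) : TotallySeparatedSpace (G ⧸ N) := by
  rw [totallySeparatedSpace_iff_exists_isClopen]
  intro x y hxy
  obtain ⟨a, rfl⟩ := QuotientGroup.mk_surjective x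
  obtain ⟨b, rfl⟩ := QuotientGroup.mk_surjective y
  have hab : a⁻¹ * b ∉ N := fun h => hxy (QuotientGroup.eq.2 h)
  -- an open subgroup `O ⊇ N` missing `a⁻¹ b`
  obtain ⟨O, ⟨hOopen, hNO⟩, habO⟩ : ∃ O ∈ {O : Subgroup G | IsOpen (O : Set G) ∧
      (⟨N, hN⟩ : ClosedSubgroup G) ≤ O}, a⁻¹ * b ∉ O := by
    by_contra h
    apply hab
    have hmem : a⁻¹ * b ∈ ((⟨N, hN⟩ : ClosedSubgroup G) : Subgroup G) := by
      rw [ProfiniteGrp.closedSubgroup_eq_sInf_open]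
      exact Subgroup.mem_sInf.2 fun O hO => by_contra fun hc => h ⟨O, hO, hc⟩
    exact hmem
  have hNO' : N ≤ O := hNO
  -- the clopen saturated set `aO` and its image
  let s : Set G := (Homeomorph.mulLeft a) '' (O : Set G)
  have hs_open : IsOpen s := (Homeomorph.mulLeft a).isOpenMap _ hOopen
  have hs_closed : IsClosed s :=
    (Homeomorph.mulLeft a).isClosedMap _ (O.isClosed_of_isOpen hOopen)
  have hsat : ((↑) : G → G ⧸ N) ⁻¹' (((↑) : G → G ⧸ N) '' s) = s := by
    ext g
    constructor
    · rintro ⟨g', ⟨o, ho, rfl⟩, hg'⟩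
      have h1 : (a * o)⁻¹ * g ∈ N := QuotientGroup.eq.1 hg'
      refine ⟨o * ((a * o)⁻¹ * g), O.mul_mem ho (hNO' h1), ?_⟩
      show a * (o * ((a * o)⁻¹ * g)) = g
      group
    · intro hg
      exact ⟨g, hg, rfl⟩
  refine ⟨((↑) : G → G ⧸ N) '' s, ⟨?_, QuotientGroup.isOpenMap_coe s hs_open⟩, ?_, ?_⟩
  · rw [← (QuotientGroup.isQuotientMap_mk N).isClosed_preimage, hsat]
    exact hs_closed
  · exact ⟨a, ⟨1, O.one_mem, mul_one a⟩, rfl⟩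
  · rintro ⟨g, ⟨o, ho, rfl⟩, hgo⟩
    have h1 : (a * o)⁻¹ * b ∈ N := QuotientGroup.eq.1 hgo
    have h2 : a⁻¹ * b = o * ((a * o)⁻¹ * b) := by group
    exact habO (h2 ▸ O.mul_mem ho (hNO' h1))

/-- `G_{F,S}` is totally separated (profinite), `F` a number field. [folklore] -/
instance instTotallySeparatedSpace_galoisGroupUnramifiedOutside (F : Type) [Field F] [NumberField F]
    (S : Set (HeightOneSpectrum (𝓞 F))) : TotallySeparatedSpace (GaloisGroupUnramifiedOutside F S) :=
  totallySeparatedSpace_quotient_of_isClosed _ (ramificationSubgroup_isClosed F S)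

end ProfiniteQuotient

/-! ## 2. The registered stub -/

section Stub

/-- **`stub_noetherianOf` (registered): hosts are Noetherian, given Chenevier's universal ring and
`Φ_p` for `G_{F,S}`.**  The host's determinant `(T, det₂)` descends to a continuous determinant of the
profinite group `G_{F,S}`, `S = badSet p ρ` finite (`badSet_finite`), reducing to `D̄ = D mod 𝔪_R` over
the finite discrete residue field; the classifying map `φ : R^u → ℋ.R` of Chenevier's universal ring
hits every `T g`, so it is onto by (G) and `ℋ.R` is a quotient of the Noetherian `R^u`
(`Host.isNoetherianRing_of_cover`).
[cite: Chenevier2014, §3.1 Prop. 3.3, Remark 3.5 and Prop. 3.7 (condition (F))] -/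
theorem stub_noetherianOf : Chenevier2014_universalDeterminantRingTwo → galoisGroupUnramifiedOutside_phiP → ∀ (F : Type) [Field F] [NumberField F] (p : ℕ) [Fact p.Prime], 5 ≤ p → ∀ (O : ValuationSubring (PadicAlgCl p)), O = (Valued.v : Valuation (PadicAlgCl p) NNReal).valuationSubring → ∀ (ρ : FramedGaloisRep F (PadicAlgCl p) 2) (ρ₀ : absoluteGaloisGroup F →* GL (Fin 2) O), ρ.HasUpperTriangularIntegralModel ρ₀ → (∀ᶠ v in cofinite, ρ.IsUnramifiedAt v) → ∀ (ℋ : Host p O ρ ρ₀), IsNoetherianRing ℋ.R := by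
  intro hC hΦ F _ _ p _ hp O _ ρ ρ₀ _ hur ℋ
  have hp3 : 3 ≤ p := by omega
  have hPhi : MazurPhiP p (GaloisGroupUnramifiedOutside F (badSet p ρ)) :=
    hΦ F (badSet p ρ) (badSet_finite p hur) p
  -- the finite residue field, with its (discrete) quotient topology
  letI : Field (ℋ.R ⧸ IsLocalRing.maximalIdeal ℋ.R) := Ideal.Quotient.field _
  haveI : Finite (ℋ.R ⧸ IsLocalRing.maximalIdeal ℋ.R) := finite_quotient_maximalIdeal_of_compact
  haveI : CharP (ℋ.R ⧸ IsLocalRing.maximalIdeal ℋ.R) p :=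
    charP_residueField_of_mem_maximalIdeal ℋ.mem_maximalIdeal
  haveI : DiscreteTopology (ℋ.R ⧸ IsLocalRing.maximalIdeal ℋ.R) :=
    discreteTopology_quotient_maximalIdeal_of_compact
  have hπc : Continuous (Ideal.Quotient.mk (IsLocalRing.maximalIdeal ℋ.R)) :=
    continuous_mk_maximalIdeal
  -- the host's determinant on `G_{F,S}` (only its trace `TS` and its continuity matter below)
  obtain ⟨DA, hDAtr, hDA⟩ : ∃ DA : PseudoRep2 (GaloisGroupUnramifiedOutside F (badSet p ρ)) ℋ.R,
      (∀ q, DA.trace q = ℋ.TS q) ∧ DA.IsContinuous :=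
    ⟨toPseudoRep2 (ℋ.TS : GaloisGroupUnramifiedOutside F (badSet p ρ) → ℋ.R) ℋ.TS.isPseudocharacter
        (ℋ.halfOf hp3) (ℋ.halfOf_mul_two hp3),
      fun _ => rfl, isContinuous_toPseudoRep2 ℋ.TS _ (ℋ.halfOf_mul_two hp3)⟩
  have hDbar : (DA.map (Ideal.Quotient.mk (IsLocalRing.maximalIdeal ℋ.R))).IsContinuous :=
    ⟨hπc.comp hDA.continuous_trace, hπc.comp hDA.continuous_det⟩
  obtain ⟨Ru, _, _, _, _, _, _, _, πu, Du, -, -, -, -, huniv⟩ :=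
    hC p (GaloisGroupUnramifiedOutside F (badSet p ρ)) hPhi (ℋ.R ⧸ IsLocalRing.maximalIdeal ℋ.R)
      (DA.map (Ideal.Quotient.mk (IsLocalRing.maximalIdeal ℋ.R))) hDbar
  obtain ⟨φ, hφ, hφD⟩ := huniv ℋ.R (Ideal.Quotient.mk (IsLocalRing.maximalIdeal ℋ.R)) hπc
    Ideal.Quotient.mk_surjective DA hDA rfl
  refine ℋ.isNoetherianRing_of_cover φ hφ fun g =>
    ⟨Du.trace (toUnramifiedQuot F (badSet p ρ) g), ?_⟩
  have h := congrArg (fun D : PseudoRep2 (GaloisGroupUnramifiedOutside F (badSet p ρ)) ℋ.R =>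
    D.trace (toUnramifiedQuot F (badSet p ρ) g)) hφD
  simp only [PseudoRep2.map_trace] at h
  rw [h, hDAtr, Host.TS_mk]

end Stub

end Summit.Langlands.Langlands.Cruxes.ProModularOfGKBound.TwoLeafFern

end
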